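import Literature.AlgebraicGeometry.Motives.CurvePlaces
import Literature.AlgebraicGeometry.Motives.CartierDivisorCurveDegree
import Literature.NumberTheory.DiophantineGeometry.FunctionFieldDivisorsAdicProofs
import Literature.NumberTheory.DiophantineGeometry.FunctionFieldGenusApproximationProofs
import Mathlib.RingTheory.DiscreteValuationRing.TFAE
import HarnessLib

/-!
# Divisors on a complete nonsingular curve and divisors of its function field:
# `Γ(C, 𝒪(D)) = 𝓛(D)`, `h⁰ = ℓ`, degrees (Hartshorne II.6, IV.1; Stichtenoth I.4)

Continuing `Motives/CurvePlaces` (closed points of the smooth complete curve `C / K` ↔ places of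
`K(C)/K`), this file completes the dictionary between the concrete divisor model of
`Motives/CartierDivisor` / `CartierDivisorCurveDegree` and the function-field library
`NumberTheory/DiophantineGeometry/FunctionFieldDivisors` (where the Riemann–Roch theorem is
proved, `FunctionFieldAdelesProofs`):

* `ord_placeOfPoint`, `ord_place`, `ord_eq_ord_pointOfPlace` — **`ord_{place x} f = ord_x(f)`**:
  the normalised valuation of the place of `x` is Mathlib's order of vanishing `Scheme.ord`
  (both count the power of a uniformizer: `IsDiscreteValuationRing.ord_eq_addVal_toNat`,
  `ord_toFunctionField_eq_addVal`; a DVR point has codimension one,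
  `coheight_eq_one_of_isDiscreteValuationRing`);
* `isRegularAt_iff_ord_nonneg` — `f ∈ 𝒪_{X,x} ↔ ord_x(f) ≥ 0` at a DVR point;
* `toDivisor C D : Divisor K K(C)` — the divisor `Σ_v ord_{x_v}(D) · v` of a Cartier divisor
  (finite support, `CartierDivisor.finite_support_cycle`), additive, invariant under `SameDivisor`,
  with **`toDivisor (div f) = (f)`** (`toDivisor_principal`);
* **`sections_eq_riemannRochSpace : Γ(C, 𝒪_C(D)) = 𝓛(toDivisor D)`** inside `K(C)` and
  **`h0_eq_ell : h⁰(C, 𝒪(D)) = ℓ(toDivisor D)`** (Hartshorne IV.1: `ℓ(D) = dim_k H⁰(X, 𝓛(D))`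
  with `H⁰(X, 𝓛(D)) = {f ∈ K(X) : (f) + D ≥ 0}`);
* `degree_placeOfPoint`, `degree_place` — **`deg (place x) = [κ(x) : K]`** (the residue degree
  of `C → Spec K` at `x`; `residueDegree_over_eq_finrank`), and
  **`degree_toDivisor : deg (toDivisor D) = deg_K D`** (`CartierDivisor.degree`, Fulton Def. 1.4).

Everything is proved; no named facts (D-0026). With `AlgFunctionField.riemann_roch_holds` this
gives Riemann–Roch for `h⁰` of Cartier divisors on smooth complete curves (sibling file).

Mathlib searched (pin): `Scheme.ord`, `Scheme.ord_eq_iff`, `Scheme.ord_mul`, `Ring.ordFrac_eq_ord`,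
`Ring.ordMonoidWithZeroHom_eq_coe`, `Ring.ord_of_irreducible`, `ringKrullDim_stalk_eq_coheight`,
`IsDiscreteValuationRing.ringKrullDim_eq_one`, `IsDiscreteValuationRing.addVal_def`,
`IsFractionRing.div_surjective`, `Scheme.Spec.residueFieldIso`, `Ideal.algEquivResidueFieldOfField`,
`Algebra.finrank_eq_of_equiv_equiv`, `IsLocalRing.ResidueField.mapEquiv`, `finsum_comp_equiv`,
`finsum_eq_sum_of_support_subset` (all used).

## References

* R. Hartshorne, *Algebraic Geometry*, GTM 52 (1977): II.6 (divisors on curves, Lemma 6.5,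
  Cor. 6.6), IV.1 (Riemann–Roch: `ℓ(D) = dim H⁰(X, 𝓛(D))`, degree). [Hartshorne1977]
* H. Stichtenoth, *Algebraic Function Fields and Codes*, 2nd ed., GTM 254 (2009): Def. 1.1.14
  (degree of a place), Thm. 1.1.13, Def. 1.4.1–1.4.4 (divisors, `𝓛(A)`). [Stichtenoth2009]
* W. Fulton, *Intersection Theory*, 2nd ed. (1998), Def. 1.4 (degree `Σ n_P [R(P):K]`). [Fulton1998]
-/

noncomputable section

open CategoryTheory AlgebraicGeometry IsLocalRing

universe u

namespace Literature.AlgebraicGeometry.Motives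

namespace CurvePlaces

open RatFn Literature.NumberTheory.DiophantineGeometry
  Literature.NumberTheory.DiophantineGeometry.AlgFunctionField

variable {K : Type u} [Field K]

/-! ### Orders: `ord_{place x} = ord_x` -/

section Ord

variable {X : Scheme.{u}} [IsIntegral X] {x : X} [IsDiscreteValuationRing (X.presheaf.stalk x)]

/-- **A point with a discrete valuation ring as local ring has codimension one**
(Mathlib `ringKrullDim_stalk_eq_coheight` and `dim 𝒪 = 1` for a DVR). [folklore] -/
theorem coheight_eq_one_of_isDiscreteValuationRing : Order.coheight x = 1 := by
  have h := ringKrullDim_stalk_eq_coheight x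
  rw [IsDiscreteValuationRing.ringKrullDim_eq_one] at h
  exact_mod_cast h.symm

/-- In a discrete valuation ring, `Ring.ord` (length of `R/(t)`) is the additive valuation:
both are `n` on `u ϖⁿ`. [folklore] -/
theorem _root_.IsDiscreteValuationRing.ord_eq_addVal_toNat {R : Type*} [CommRing R] [IsDomain R]
    [IsDiscreteValuationRing R] {t : R} (ht : t ≠ 0) :
    Ring.ord R t = (IsDiscreteValuationRing.addVal R t).toNat := by
  obtain ⟨ϖ, hϖ⟩ := IsDiscreteValuationRing.exists_irreducible R
  obtain ⟨n, u, rfl⟩ := IsDiscreteValuationRing.eq_unit_mul_pow_irreducible ht hϖ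
  rw [IsDiscreteValuationRing.addVal_def _ u hϖ n rfl, Ring.ord_mul_of_isUnit_left u.isUnit,
    Ring.ord_pow (mem_nonZeroDivisors_of_ne_zero hϖ.ne_zero), Ring.ord_of_irreducible hϖ]
  simp

/-- The additive valuation is invariant under ring isomorphisms of discrete valuation rings
(the same folklore lemma is `Literature.NumberTheory.GaloisRepresentations.addVal_map_ringEquiv` of
`GaloisRepresentations/DivisorClassGaloisAction`, whose representation-theoretic import closure is
not wanted here; kept private). [folklore] -/
private theorem addVal_map_ringEquiv' {R S : Type*} [CommRing R] [IsDomain R]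
    [IsDiscreteValuationRing R] [CommRing S] [IsDomain S] [IsDiscreteValuationRing S]
    (e : R ≃+* S) (t : R) :
    IsDiscreteValuationRing.addVal S (e t) = IsDiscreteValuationRing.addVal R t := by
  by_cases ht : t = 0
  · subst ht; simp
  obtain ⟨ϖ, hϖ⟩ := IsDiscreteValuationRing.exists_irreducible R
  obtain ⟨n, u, rfl⟩ := IsDiscreteValuationRing.eq_unit_mul_pow_irreducible ht hϖ
  have hϖ' : Irreducible (e ϖ) := (MulEquiv.irreducible_iff (e : R ≃* S)).mpr hϖ
  rw [IsDiscreteValuationRing.addVal_def _ u hϖ n rfl,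
    IsDiscreteValuationRing.addVal_def (e (u * ϖ ^ n)) (Units.map (e : R →* S) u) hϖ' n
      (by rw [map_mul, map_pow]; rfl)]

/-- **The order of vanishing of a regular germ**: for `0 ≠ t ∈ 𝒪_{X,x}`, a discrete valuation
ring, `ord_x(t) = v(t)` (Mathlib `Scheme.ord` through `Ring.ordFrac`, versus the additive valuation).
[folklore] -/
theorem ord_toFunctionField_eq_addVal [IsLocallyNoetherian X] {t : X.presheaf.stalk x} (ht : t ≠ 0) :
    Scheme.ord (toFunctionField x t) x = ((IsDiscreteValuationRing.addVal _ t).toNat : ℤ) := by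
  have hx : Order.coheight x = 1 := coheight_eq_one_of_isDiscreteValuationRing
  haveI : Ring.KrullDimLE 1 (X.presheaf.stalk x) := krullDimLE_of_coheight_le hx.le
  have h0 : toFunctionField x t ≠ 0 := (map_ne_zero_iff _ (toFunctionField_injective x)).mpr ht
  have ht' : t ∈ nonZeroDivisors (X.presheaf.stalk x) := mem_nonZeroDivisors_of_ne_zero ht
  rw [Scheme.ord_eq_iff hx h0]
  change Ring.ordFrac (X.presheaf.stalk x) (algebraMap _ X.functionField t) = _
  rw [Ring.ordFrac_eq_ord _ ht,
    Ring.ordMonoidWithZeroHom_eq_coe _ ht' (IsDiscreteValuationRing.ord_eq_addVal_toNat ht)]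

variable [X.Over (Spec (.of K))]

/-- **`ord_{place x} = ord_x`**: the normalised valuation of the place attached to `x` is the
order of vanishing at `x` (Hartshorne II.6: `v_P` is the valuation of `𝒪_P`; both count the power
of a uniformizer). [cite: Hartshorne1977, II.6 (before Lemma 6.5)] -/
theorem ord_placeOfPoint [IsLocallyNoetherian X] {f : X.functionField} (hf : f ≠ 0) :
    (placeOfPoint (K := K) x).ord f = Scheme.ord f x := by
  -- write `f = a / b` with `a, b ∈ 𝒪_{X,x}` nonzero
  obtain ⟨a, b, hb, hab⟩ := IsFractionRing.div_surjective (A := X.presheaf.stalk x) f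
  have hb0 : (b : X.presheaf.stalk x) ≠ 0 := nonZeroDivisors.ne_zero hb
  have ha0 : a ≠ 0 := by
    rintro rfl
    apply hf
    rw [← hab, map_zero, zero_div]
  have hfb : f * toFunctionField x b = toFunctionField x a := by
    rw [← hab]
    change algebraMap _ _ a / algebraMap _ _ b * algebraMap _ _ b = algebraMap _ _ a
    rw [div_mul_cancel₀]
    exact (map_ne_zero_iff _ (toFunctionField_injective x)).mpr hb0
  -- function-field side: the fraction formula
  let e : X.presheaf.stalk x ≃+* (placeOfPoint (K := K) x).toValuationSubring := stalkEquivOfPoint x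
  have h1 := PlaceOver.ord_eq_sub_of_mul_eq (placeOfPoint (K := K) x) hf (a := e a) (b := e b)
    ((map_ne_zero_iff _ e.injective).mpr ha0) ((map_ne_zero_iff _ e.injective).mpr hb0) hfb
  -- scheme side: additivity of `ord_x`
  have h2 : Scheme.ord f x = Scheme.ord (toFunctionField x a) x - Scheme.ord (toFunctionField x b) x := by
    have := Scheme.ord_mul (x := x) hf ((map_ne_zero_iff _ (toFunctionField_injective x)).mpr hb0)
    rw [hfb] at this
    omega
  rw [h1, h2, ord_toFunctionField_eq_addVal ha0, ord_toFunctionField_eq_addVal hb0,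
    addVal_map_ringEquiv' e a, addVal_map_ringEquiv' e b]

end Ord

/-! ### Regularity and order of vanishing at a discrete valuation ring point -/

section Regular

variable {X : Scheme.{u}} [IsIntegral X] [IsLocallyNoetherian X] {x : X}
  [IsDiscreteValuationRing (X.presheaf.stalk x)]

/-- **`f` is regular at `x` iff `ord_x(f) ≥ 0`** (`f ≠ 0`, `𝒪_{X,x}` a discrete valuation ring):
if `f` is not regular then `f⁻¹ ∈ 𝔪_x`, so `ord_x(f⁻¹) > 0` and `ord_x(f) < 0` (the tree's
`IsRegularAt.ord_nonneg`, `IsRegularAt.ord_pos`). [cite: Hartshorne1977, II.6 (valuations of K(C)/K)] -/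
theorem isRegularAt_iff_ord_nonneg {f : X.functionField} (hf : f ≠ 0) :
    IsRegularAt x f ↔ 0 ≤ Scheme.ord f x := by
  refine ⟨fun h ↦ h.ord_nonneg, fun h ↦ ?_⟩
  by_contra hreg
  have hx : Order.coheight x = 1 := coheight_eq_one_of_isDiscreteValuationRing
  -- `f⁻¹` is regular but not a unit at `x`
  have hinv : IsRegularAt x f⁻¹ := by
    rcases ValuationRing.isInteger_or_isInteger (X.presheaf.stalk x) f with ⟨a, ha⟩ | ⟨a, ha⟩
    · exact absurd ⟨a, ha⟩ hreg
    · exact ⟨a, ha⟩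
  have hnu : ¬ IsUnitAt x f⁻¹ := fun hu ↦ hreg (by simpa using hu.inv.isRegularAt)
  have hpos := hinv.ord_pos hnu (inv_ne_zero hf) hx
  have hsum : Scheme.ord f x + Scheme.ord f⁻¹ x = 0 := by
    rw [← Scheme.ord_mul hf (inv_ne_zero hf), mul_inv_cancel₀ hf]
    have h1 := Scheme.ord_mul (x := x) (one_ne_zero (α := X.functionField)) one_ne_zero
    rw [mul_one] at h1
    omega
  omega

end Regular

/-! ### The divisor of `K(C)/K` attached to a Cartier divisor on the curve `C` -/

section Curve

variable (C : SchemeOver K) [IsIntegral C.left] [SmoothOfRelativeDimension 1 C.hom] [IsProper C.hom]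

/-- The smooth curve `C` is locally noetherian. [folklore] -/
instance isLocallyNoetherian_of_smoothCurve : IsLocallyNoetherian C.left :=
  haveI : Smooth C.hom := SmoothOfRelativeDimension.smooth 1 C.hom
  LocallyOfFiniteType.isLocallyNoetherian C.hom

/-- The local ring at the point of a place is a discrete valuation ring. [folklore] -/
instance isDiscreteValuationRing_stalk_pointOfPlace (v : PlaceOver K C.left.functionField) :
    IsDiscreteValuationRing (C.left.presheaf.stalk (pointOfPlace (C := C) v)) :=
  isDiscreteValuationRing_stalk C (pointOfPlace_ne_genericPoint v)

variable {C} in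
/-- `place (pointOfPlace v) = v` in the `placeOfPoint` form (for rewriting under binders). [folklore] -/
theorem placeOfPoint_pointOfPlace (v : PlaceOver K C.left.functionField) :
    placeOfPoint (K := K) (pointOfPlace (C := C) v) = v :=
  place_pointOfPlace (C := C) v

variable {C} in
/-- **`ord_{place x} f = ord_x(f)`** on the smooth curve (`f ≠ 0`; `ord_placeOfPoint`). [cite: Hartshorne1977, II.6 (before Lemma 6.5)] -/
theorem ord_place {x : C.left} (hx : x ≠ genericPoint C.left) {f : C.left.functionField} (hf : f ≠ 0) :
    (place C x hx).ord f = Scheme.ord f x :=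
  haveI := isDiscreteValuationRing_stalk C hx
  ord_placeOfPoint hf

variable {C} in
/-- **`ord_v f = ord_{x_v}(f)`** for the point `x_v` of the place `v` (`f ≠ 0`). [cite: Hartshorne1977, II.6 (before Lemma 6.5)] -/
theorem ord_eq_ord_pointOfPlace (v : PlaceOver K C.left.functionField) {f : C.left.functionField}
    (hf : f ≠ 0) : v.ord f = Scheme.ord f (pointOfPlace (C := C) v) := by
  conv_lhs => rw [← placeOfPoint_pointOfPlace (C := C) v]
  exact ord_placeOfPoint hf

/-- **The divisor of `K(C)/K` of a Cartier divisor `D` on the complete nonsingular curve `C`**: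
`v ↦ ord_{x_v}(D)` (Hartshorne II.6: `Div C` = free abelian group on the closed points = on the
places; the support is finite, `CartierDivisor.finite_support_cycle`). [cite: Hartshorne1977, II.6 (divisors on curves) and Cor. 6.6] -/
def toDivisor (D : CartierDivisor C.left) : Divisor K C.left.functionField :=
  Finsupp.ofSupportFinite (fun v ↦ D.ordAt (pointOfPlace (C := C) v)) (by
    apply (D.finite_support_cycle (C := C)).preimage
    exact fun v _ w _ h ↦ (pointEquivPlace (C := C)).symm.injective (Subtype.ext h))

/-- `toDivisor D v = ord_{x_v}(D)`. [folklore] -/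
@[simp]
theorem toDivisor_apply (D : CartierDivisor C.left) (v : PlaceOver K C.left.functionField) :
    toDivisor C D v = D.ordAt (pointOfPlace (C := C) v) := rfl

/-- `toDivisor D (place x) = ord_x(D)`. [folklore] -/
theorem toDivisor_place (D : CartierDivisor C.left) {x : C.left} (hx : x ≠ genericPoint C.left) :
    toDivisor C D (place C x hx) = D.ordAt x := by
  rw [toDivisor_apply, pointOfPlace_place]

/-- `toDivisor (D + E) = toDivisor D + toDivisor E`. [folklore] -/
theorem toDivisor_add (D E : CartierDivisor C.left) :
    toDivisor C (D + E) = toDivisor C D + toDivisor C E := by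
  ext v
  simp [CartierDivisor.ordAt_add]

/-- Presentations of the same divisor have the same divisor of `K(C)/K`. [folklore] -/
theorem SameDivisor.toDivisor_eq {D E : CartierDivisor C.left} (h : D.SameDivisor E) :
    toDivisor C D = toDivisor C E := by
  ext v
  simp [h.ordAt_eq]

/-- The set of places where a nonzero rational function has nonzero order is finite (it is the set
of places of the support of `div(f)`). [folklore] -/
theorem finite_setOf_ord_ne_zero {f : C.left.functionField} (hf : f ≠ 0) :
    {v : PlaceOver K C.left.functionField | v.ord f ≠ 0}.Finite := by
  have h := (CartierDivisor.principal f hf).finite_support_cycle (C := C)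
  refine (h.preimage (f := fun v ↦ pointOfPlace (C := C) v) ?_).subset ?_
  · exact fun v _ w _ h ↦ (pointEquivPlace (C := C)).symm.injective (Subtype.ext h)
  · intro v hv
    simp only [Set.mem_preimage, Function.mem_support, CartierDivisor.cycle_apply,
      CartierDivisor.ordAt_principal]
    rwa [← ord_eq_ord_pointOfPlace v hf]

/-- **`toDivisor (div f) = (f)`**: the divisor of `K(C)/K` of a principal Cartier divisor is the
principal divisor of the function field (Hartshorne II.6; Stichtenoth Def. 1.4.2). [cite: Hartshorne1977, II.6 (principal divisors on curves)] -/
theorem toDivisor_principal {f : C.left.functionField} (hf : f ≠ 0) :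
    toDivisor C (CartierDivisor.principal f hf) = principalDivisor K f := by
  ext v
  rw [toDivisor_apply, CartierDivisor.ordAt_principal,
    principalDivisor_apply (finite_setOf_ord_ne_zero C hf), ord_eq_ord_pointOfPlace v hf]

/-! ### Global sections `Γ(C, 𝒪(D))` are the Riemann–Roch space `𝓛(D)` -/

/-- **`Γ(C, 𝒪_C(D)) = 𝓛(D)`** inside `K(C)`: a rational function `s` is a global section of
`𝒪(D)` (`f_i s` regular on `U_i`) iff `(s) + D ≥ 0` iff `s ∈ 𝓛(toDivisor D)` (Hartshorne II.7
/ IV.1: `H⁰(C, 𝓛(D)) = {f ∈ K(C) : (f) + D ≥ 0}`; Stichtenoth Def. 1.4.4). The condition at the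
generic point is vacuous and at a closed point `x` it reads `ord_x(f_i) + ord_x(s) ≥ 0`
(`isRegularAt_iff_ord_nonneg`). [cite: Hartshorne1977, IV.1 (Riemann–Roch, ℓ(D) = dim H⁰(X, 𝓛(D)))] -/
theorem sections_eq_riemannRochSpace (D : CartierDivisor C.left) :
    D.sections K = riemannRochSpace (toDivisor C D) := by
  ext s
  by_cases hs : s = 0
  · subst hs; simp
  rw [CartierDivisor.mem_sections_iff, mem_riemannRochSpace_iff_ord_holds _ hs]
  constructor
  · intro h v
    obtain ⟨i, hi⟩ := D.covers (pointOfPlace (C := C) v)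
    have hreg := h i _ hi
    have hfi : D.f i * s ≠ 0 := mul_ne_zero (D.f_ne_zero i) hs
    rw [isRegularAt_iff_ord_nonneg hfi, Scheme.ord_mul (D.f_ne_zero i) hs,
      ← D.ordAt_eq_ord hi] at hreg
    rw [toDivisor_apply, ord_eq_ord_pointOfPlace v hs]
    omega
  · intro h i x hi
    by_cases hx : x = genericPoint C.left
    · subst hx; exact isRegularAt_genericPoint _
    haveI := isDiscreteValuationRing_stalk C hx
    have hfi : D.f i * s ≠ 0 := mul_ne_zero (D.f_ne_zero i) hs
    rw [isRegularAt_iff_ord_nonneg hfi, Scheme.ord_mul (D.f_ne_zero i) hs, ← D.ordAt_eq_ord hi]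
    have hv := h (place C x hx)
    rw [toDivisor_place, ord_place hx hs] at hv
    omega

/-- **`h⁰(C, 𝒪(D)) = ℓ(toDivisor D)`**: the dimension of the space of global sections of the
Cartier divisor `D` on the complete nonsingular curve `C` is the dimension `ℓ` of the Riemann–Roch
space of its divisor of `K(C)/K` (Hartshorne IV.1). [cite: Hartshorne1977, IV.1 (ℓ(D) = dim_k H⁰(X, 𝓛(D)))] -/
theorem h0_eq_ell (D : CartierDivisor C.left) : D.h0 K = ell (toDivisor C D) := by
  unfold CartierDivisor.h0 ell
  rw [sections_eq_riemannRochSpace]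

end Curve

/-! ### Degrees: `deg (place x) = [κ(x) : K]` and `deg (toDivisor D) = deg_K D` -/

section Degree

variable {X : Scheme.{u}} [IsIntegral X] [X.Over (Spec (.of K))] {x : X}

omit [IsIntegral X] in
/-- The structure map `K → κ(pt)` to the residue field of `Spec K` at a point is an isomorphism
(Mathlib `Spec.residueFieldIso` and `Ideal.algEquivResidueFieldOfField`). [folklore] -/
def baseResidueEquiv (p : Spec (.of K)) : K ≃+* (Spec (.of K)).residueField p :=
  (Ideal.algEquivResidueFieldOfField p.asIdeal).toRingEquiv.trans
    (Scheme.Spec.residueFieldIso (.of K) p).commRingCatIsoToRingEquiv.symm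

omit [IsIntegral X] in
/-- `baseResidueEquiv p c` is the residue of the germ of the constant `c`. [folklore] -/
theorem baseResidueEquiv_apply (p : Spec (.of K)) (c : K) :
    baseResidueEquiv (K := K) p c = (Spec (.of K)).residue p
      ((Spec (.of K)).presheaf.germ ⊤ p trivial ((Scheme.ΓSpecIso (.of K)).inv c)) := by
  have h := Scheme.Spec.algebraMap_residueFieldIso_inv (.of K) p
  have h' := congrArg (fun f : CommRingCat.of K ⟶ (Spec (.of K)).residueField p ↦ f c) h
  change (Scheme.Spec.residueFieldIso (.of K) p).inv (algebraMap K p.asIdeal.ResidueField c) = _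
  exact h'

omit [IsIntegral X] in
/-- **The residue degree of `X → Spec K` at `x` is `[κ(x) : K]`** for the `K`-structure
`K → 𝒪_{X,x} → κ(x)` (`RatFn.algebraStalk` and the quotient algebra). [folklore] -/
theorem residueDegree_over_eq_finrank (x : X) :
    (X ↘ Spec (.of K)).residueDegree x =
      Module.finrank K (IsLocalRing.ResidueField (X.presheaf.stalk x)) := by
  let f := X ↘ Spec (.of K)
  letI := (f.residueFieldMap x).hom.toAlgebra
  symm
  unfold Scheme.Hom.residueDegree
  refine Algebra.finrank_eq_of_equiv_equiv (baseResidueEquiv (K := K) (f x)) (RingEquiv.refl _) ?_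
  ext c
  change (f.residueFieldMap x).hom (baseResidueEquiv (K := K) (f x) c) =
    IsLocalRing.residue _ (algebraMap K (X.presheaf.stalk x) c)
  rw [baseResidueEquiv_apply, ← CommRingCat.comp_apply, Scheme.residue_residueFieldMap,
    CommRingCat.comp_apply]
  erw [Scheme.Hom.germ_stalkMap_apply]
  rfl

variable [IsDiscreteValuationRing (X.presheaf.stalk x)]

/-- The residue field of the place of `x` is that of `𝒪_{X,x}`, `K`-linearly. [folklore] -/
def residueFieldEquivPlace (x : X) [IsDiscreteValuationRing (X.presheaf.stalk x)] :
    IsLocalRing.ResidueField (X.presheaf.stalk x) ≃ₐ[K] (placeOfPoint (K := K) x).residueField :=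
  AlgEquiv.ofRingEquiv (f := IsLocalRing.ResidueField.mapEquiv (stalkEquivOfPoint x)) fun c ↦ by
    rw [IsLocalRing.ResidueField.mapEquiv_apply, PlaceOver.algebraMap_residueField_apply]
    change IsLocalRing.ResidueField.map _ (IsLocalRing.residue _ (algebraMap K (X.presheaf.stalk x) c)) = _
    rw [IsLocalRing.ResidueField.map_residue]
    congr 1
    apply Subtype.ext
    change toFunctionField x (algebraMap K (X.presheaf.stalk x) c) = _
    rw [PlaceOver.algebraMap_toValuationSubring_apply]
    exact (IsScalarTower.algebraMap_apply K (X.presheaf.stalk x) X.functionField c).symm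

/-- **`deg (place x) = [κ(x) : K]`**: the degree of the place of `x` is the residue degree of `x`
over `K` (Hartshorne II.6; Stichtenoth Def. 1.1.14). [cite: Stichtenoth2009, Def. 1.1.14 (degree of a place)] -/
theorem degree_placeOfPoint (x : X) [IsDiscreteValuationRing (X.presheaf.stalk x)] :
    (placeOfPoint (K := K) x).degree = (X ↘ Spec (.of K)).residueDegree x := by
  rw [residueDegree_over_eq_finrank, PlaceOver.degree]
  exact ((residueFieldEquivPlace (K := K) x).toLinearEquiv.finrank_eq).symm

end Degree

section CurveDegree

variable (C : SchemeOver K) [IsIntegral C.left] [SmoothOfRelativeDimension 1 C.hom] [IsProper C.hom]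

omit [IsProper C.hom] in
/-- `deg (place x) = [κ(x) : K]` on the smooth complete curve. [cite: Stichtenoth2009, Def. 1.1.14 (degree of a place)] -/
theorem degree_place {x : C.left} (hx : x ≠ genericPoint C.left) :
    (place C x hx).degree = C.hom.residueDegree x :=
  haveI := isDiscreteValuationRing_stalk C hx
  degree_placeOfPoint (K := K) x

omit [SmoothOfRelativeDimension 1 C.hom] in
/-- The order of any divisor at the generic point is zero (every local equation is a unit there). [folklore] -/
theorem ordAt_genericPoint (D : CartierDivisor C.left) : D.ordAt (genericPoint C.left) = 0 := by
  obtain ⟨i, hi⟩ := D.covers (genericPoint C.left)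
  rw [D.ordAt_eq_ord hi]
  exact (isUnitAt_genericPoint (D.f_ne_zero i)).ord_eq_zero

/-- **`deg (toDivisor D) = deg_K D`**: the degree of the divisor of `K(C)/K` of a Cartier divisor
is its degree `Σ_x ord_x(D) [κ(x) : K]` (`CartierDivisor.degree`, Fulton Def. 1.4; Hartshorne II.6
/ IV.1; Stichtenoth Def. 1.4.1). [cite: Hartshorne1977, IV.1 (degree of a divisor on a curve)] -/
theorem degree_toDivisor (D : CartierDivisor C.left) :
    Divisor.degree (toDivisor C D) = CartierDivisor.degree C D := by
  classical
  set g : C.left → ℤ := fun x ↦ D.ordAt x * (C.hom.residueDegree x : ℤ) with hg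
  have hdeg : CartierDivisor.degree C D = ∑ᶠ x, g x := by
    rw [CartierDivisor.degree_eq_finsum]; rfl
  -- the generic point does not contribute
  have hsupp : Function.support g ⊆ {x | x ≠ genericPoint C.left} := by
    intro x hx hxe
    apply hx
    simp only [hg, hxe, ordAt_genericPoint, zero_mul]
  have h1 : ∑ᶠ x, g x = ∑ᶠ v : PlaceOver K C.left.functionField, g (pointOfPlace (C := C) v) := by
    have ha : ∑ᶠ x, g x = ∑ᶠ x ∈ {x : C.left | x ≠ genericPoint C.left}, g x := by
      rw [finsum_mem_def, Set.indicator_eq_self.mpr hsupp]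
    have hb : ∑ᶠ j : ({x : C.left | x ≠ genericPoint C.left} : Set C.left), g j =
        ∑ᶠ x ∈ {x : C.left | x ≠ genericPoint C.left}, g x := finsum_set_coe_eq_finsum_mem _
    have hc : ∑ᶠ j : ({x : C.left | x ≠ genericPoint C.left} : Set C.left), g j =
        ∑ᶠ v : PlaceOver K C.left.functionField, g (pointOfPlace (C := C) v) := by
      rw [← finsum_comp_equiv (pointEquivPlace (C := C) :
        ({x : C.left | x ≠ genericPoint C.left} : Set C.left) ≃ PlaceOver K C.left.functionField)
        (f := fun v ↦ g (pointOfPlace (C := C) v))]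
      refine finsum_congr fun j ↦ ?_
      simp only [pointEquivPlace_apply, pointOfPlace_place]
    rw [ha, ← hb, hc]
  have h2 : ∀ v : PlaceOver K C.left.functionField,
      g (pointOfPlace (C := C) v) = toDivisor C D v * (v.degree : ℤ) := fun v ↦ by
    simp only [hg, toDivisor_apply]
    congr 2
    rw [← degree_place C (pointOfPlace_ne_genericPoint v), place_pointOfPlace]
  have hsub : Function.support (fun v ↦ toDivisor C D v * (v.degree : ℤ)) ⊆ ↑(toDivisor C D).support := by
    intro v hv
    rw [Function.mem_support] at hv
    rw [Finset.mem_coe, Finsupp.mem_support_iff]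
    exact fun h0 ↦ hv (by rw [h0, zero_mul])
  rw [hdeg, h1, Divisor.degree_apply]
  simp_rw [h2]
  rw [finsum_eq_sum_of_support_subset _ hsub]
  rfl

end CurveDegree

end CurvePlaces

end Literature.AlgebraicGeometry.Motives
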